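import Mathlib
import HarnessLib
import Summits.ValiantsHypothesis.ValiantsHypothesis.Theses.ValuativeGCT
import Literature.Computability.AlgebraicComplexity.OrbitClosureWeights
import Summits.ValiantsHypothesis.ValiantsHypothesis.Theorems.ValuativeGCTValuativeFlipGrowthGap
import Summits.ValiantsHypothesis.ValiantsHypothesis.Theorems.ValuativeGCTValuativeFlipStabInvLeExplicit
import Summits.ValiantsHypothesis.ValiantsHypothesis.Theorems.ValuativeGCTValuativeFlipFourRowSliceBound
import Summits.ValiantsHypothesis.ValiantsHypothesis.Theorems.ValuativeGCTValuativeFlipFourRowHilbertLowerBound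
import Summits.ValiantsHypothesis.ValiantsHypothesis.Theorems.ValuativeGCTValuativeFlipFourRowTransfer
import Summits.ValiantsHypothesis.ValiantsHypothesis.Theorems.ValuativeGCTHeadFlipFourRowBridge

/-!
# The linear head of the window from ONE pencil certificate (crux `ValuativeGCT.ValuativeFlip`, line `four-row-count`)

Crux `ValuativeGCT.ValuativeFlip` (stmt-ValiantsHypothesis-12624), line
`Cruxes/ValuativeFlip/Lines/four_row_count.lean`; wall-breaker k5 (gen 1, seat 2).

Three of the four head stubs of the line are theorems of the tree —
`stub_fourRowSliceBound` (det side, `Theorems/ValuativeGCTValuativeFlipFourRowSliceBound.lean`),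
`stub_fourRowHilbertLowerBound` (per side, `…FourRowHilbertLowerBound.lean`) and
`HeadFlip.stub_fourRowBridge` (`GL₄`-equivariant bridge, `…HeadFlipFourRowBridge.lean`) — and the
fourth, `stub_fourRowPencilRank`, is reduced to the `m`-free pencil hypothesis `H` of
`fourRowPencilRank_of_pencilCertificate` (`…FourRowTransfer.lean`).  This file composes them ONCE,
so that the head no longer lives only in the skeleton's glue:

* `headCensus_at` (unconditional): at a window position `n ≤ m`, `2 ≤ m`, any base point `g` whose
  four-row tangent span has dimension `≥ 2m² + m + 2` yields a partition `λ ⊢ mδ` with at most four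
  rows and `dim(Hom_{mδ} ⊓ SAND ⊓ HWSP(λ*)) < mult_{λ*} ℂ[Δ_m(X₀₀^{m-n} per_n)]`
  (growth gap `stub_growthGap` with `z = 2m² + m`, `N = z + 1`);
* `headFlipBody_of_pencilCert_at` (unconditional, POINTWISE in `n`): one four-variable pencil
  `M : Fin n × Fin n → Fin 4 → ℂ` with an invertible `4 × 4` coordinate minor and
  `2m² + m + 2 ≤ dim span{y_t · (∂_{ij} per_n)(M·y)}` gives the body of the route decl
  `ValuativeGCT.ValuativeFlip` (verbatim `let χ`, `let T`) at `(n, m)` with the no-cut centre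
  `U = ⊥`, `r = 0` (`T_⊥ ≤ Hom ⊓ SAND` by `stub_stabInv_le_explicit`, base point from
  `frt_finrank_fourRowSpan_ge`);
* `headFlipBody_of_pencilCertificate` / `headFlip_of_pencilCertificate`: the hypothesis `H` of
  `fourRowPencilRank_of_pencilCertificate` (a certificate at every large `n` of strength
  `2⌊6n/5⌋² + ⌊6n/5⌋ + 2`) gives the head of the window with slope `6/5`, i.e. the route decl
  `ValuativeGCT.HeadFlip` BY NAME with `a = 6`, `b = 5`.

So the sub-crux `HeadFlip` (stmt-ValiantsHypothesis-15535) and the head half of `ValuativeFlip`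
follow from `H` by one `exact`, whichever pencil supplies `H` (cyclic tridiagonal, Hessenberg `HB_n`,
bordered, `GBT(2)`, …).  [this crux: Lines/four_row_count.lean (glue `headCensus_of`,
`headFlipBody_of`), AxisK5G1PencilCertificateMono.md §4; BLMW 2011 §5.2; Mulmuley–Sohoni 2001 §4]
-/

set_option linter.dupNamespace false
set_option maxHeartbeats 800000

namespace Summit.ValiantsHypothesis.ValiantsHypothesis.Theorems.ValuativeFlip

open MvPolynomial
open scoped BigOperators Matrix
open Literature.NumberTheory.DiophantineGeometry
open Literature.Computability.AlgebraicComplexity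

noncomputable section

/-- **Four-row census at one window position** (unconditional form of the skeleton's
`headCensus_of`): for `n ≤ m`, `2 ≤ m` and a base point `g ∈ GL_{m²}` whose four-row tangent span of
`g · X₀₀^{m-n} per_n` has dimension `≥ 2m² + m + 2`, some `λ ⊢ mδ` with at most four rows has
`dim(Hom_{mδ} ⊓ SAND ⊓ HWSP(λ*)) < mult_{λ*} ℂ[Δ_m(X₀₀^{m-n} per_n)]`.  Composition of the landed
`stub_growthGap` (B5), `stub_fourRowSliceBound`, `stub_fourRowHilbertLowerBound` and
`HeadFlip.stub_fourRowBridge`. [this crux, line four-row-count] -/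
theorem headCensus_at (n m : ℕ) [NeZero m] (hnm : n ≤ m) (hm2 : 2 ≤ m) (g : GL (MatIdx m) ℂ)
    (hg : 2 * m ^ 2 + m + 2 ≤ Module.finrank ℂ ↥(Submodule.span ℂ (Set.range fun ab : {a : MatIdx m // m * m ≤ (((matIdxEquiv m).symm a : Fin (m * m)) : ℕ) + 4} × MatIdx m => (MvPolynomial.X ab.1.1 : MvPolynomial (MatIdx m) ℂ) * MvPolynomial.aeval (fun i : MatIdx m => if m * m ≤ (((matIdxEquiv m).symm i : Fin (m * m)) : ℕ) + 4 then (MvPolynomial.X i : MvPolynomial (MatIdx m) ℂ) else 0) (MvPolynomial.pderiv ab.2 (linSubst (MatIdx m) ℂ ((g : GL (MatIdx m) ℂ) : Matrix (MatIdx m) (MatIdx m) ℂ) (paddedPerFormLex ℂ n m)))))) :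
    ∃ (δ : ℕ) (lam : Nat.Partition (m * δ)), lam.parts.card ≤ 4 ∧
        Module.finrank ℂ ↥(MvPolynomial.homogeneousSubmodule (MatIdx m × MatIdx m) ℂ (m * δ) ⊓
          (⨅ (P : Matrix (Fin m) (Fin m) ℂ) (Q : Matrix (Fin m) (Fin m) ℂ) (_ : P.det = 1) (_ : Q.det = 1), LinearMap.ker ((MvPolynomial.aeval fun p : MatIdx m × MatIdx m => ∑ l : MatIdx m, (P (ofLex p.2).1 (ofLex l).1 * Q (ofLex l).2 (ofLex p.2).2) • (MvPolynomial.X (p.1, l) : MvPolynomial (MatIdx m × MatIdx m) ℂ)).toLinearMap - (LinearMap.id : MvPolynomial (MatIdx m × MatIdx m) ℂ →ₗ[ℂ] MvPolynomial (MatIdx m × MatIdx m) ℂ))) ⊓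
          (⨅ (g : Matrix.GeneralLinearGroup (MatIdx m) ℂ) (_ : IsUpperTriangular g), LinearMap.ker ((MvPolynomial.aeval fun p : MatIdx m × MatIdx m => ∑ l : MatIdx m, ((g⁻¹ : Matrix.GeneralLinearGroup (MatIdx m) ℂ) : Matrix (MatIdx m) (MatIdx m) ℂ) p.1 l • (MvPolynomial.X (l, p.2) : MvPolynomial (MatIdx m × MatIdx m) ℂ)).toLinearMap - weightChar ((Weight.dualOfPartition (m * m) lam).toMatIdx : Weight (MatIdx m)) g • (LinearMap.id : MvPolynomial (MatIdx m × MatIdx m) ℂ →ₗ[ℂ] MvPolynomial (MatIdx m × MatIdx m) ℂ)))) <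
        orbitMultiplicity ℂ (paddedPerFormLex ℂ n m) m ((Weight.dualOfPartition (m * m) lam).toMatIdx : Weight (MatIdx m)) := by
  have hzN : (2 * m ^ 2 + m) + 1 ≤ 2 * m ^ 2 + m + 1 := le_rfl
  obtain ⟨δ, hδ⟩ := stub_growthGap m (2 * m ^ 2 + m) (2 * m ^ 2 + m + 1) hzN
  have hN : (2 * m ^ 2 + m + 1) + 1 ≤ Module.finrank ℂ ↥(Submodule.span ℂ (Set.range fun ab : {a : MatIdx m // m * m ≤ (((matIdxEquiv m).symm a : Fin (m * m)) : ℕ) + 4} × MatIdx m => (MvPolynomial.X ab.1.1 : MvPolynomial (MatIdx m) ℂ) * MvPolynomial.aeval (fun i : MatIdx m => if m * m ≤ (((matIdxEquiv m).symm i : Fin (m * m)) : ℕ) + 4 then (MvPolynomial.X i : MvPolynomial (MatIdx m) ℂ) else 0) (MvPolynomial.pderiv ab.2 (linSubst (MatIdx m) ℂ ((g : GL (MatIdx m) ℂ) : Matrix (MatIdx m) (MatIdx m) ℂ) (paddedPerFormLex ℂ n m))))) := by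
    have h22 : (2 * m ^ 2 + m + 1) + 1 = 2 * m ^ 2 + m + 2 := by ring
    rw [h22]
    exact hg
  have h3 := stub_fourRowHilbertLowerBound n m hnm g (2 * m ^ 2 + m + 1) δ hN
  have h1 := stub_fourRowSliceBound m hm2 (m * δ)
  have hgap := lt_of_le_of_lt h1 (lt_of_lt_of_le hδ h3)
  obtain ⟨lam, hcard, hlt⟩ :=
    Summit.ValiantsHypothesis.ValiantsHypothesis.Theorems.HeadFlip.stub_fourRowBridge n m δ hnm hm2 hgap
  exact ⟨δ, lam, hcard, hlt⟩

/-- **The flip body at one window position from one pencil certificate** (unconditional,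
pointwise in `n`): if a four-variable pencil `M` of size `n` has an invertible `4 × 4` coordinate
minor and `2m² + m + 2 ≤ dim span{y_t · (∂_{ij} per_n)(M·y)}`, then for `n ≤ m`, `2 ≤ m` the body of
`ValuativeGCT.ValuativeFlip` holds at `(n, m)` (verbatim `let χ`, `let T`), with `U = ⊥`, `r = 0`
and a shape with at most four rows.  Base point by `frt_finrank_fourRowSpan_ge`, census by
`headCensus_at`, `T_⊥ ≤ Hom ⊓ SAND ⊓ HWSP` by `stub_stabInv_le_explicit`. [this crux, line four-row-count] -/
theorem headFlipBody_of_pencilCert_at (n m : ℕ) [NeZero m] (hnm : n ≤ m) (hm2 : 2 ≤ m)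
    (M : Fin n × Fin n → Fin 4 → ℂ) (c : Fin 4 → Fin n × Fin n)
    (hc : IsUnit (Matrix.of fun t t' : Fin 4 => M (c t') t))
    (hrank : 2 * m ^ 2 + m + 2 ≤
      Module.finrank ℂ ↥(Submodule.span ℂ (Set.range fun tc : Fin 4 × (Fin n × Fin n) =>
          (X tc.1 : MvPolynomial (Fin 4) ℂ) *
            aeval (fun ij : Fin n × Fin n => ∑ t : Fin 4, M ij t • (X t : MvPolynomial (Fin 4) ℂ))
              (pderiv tc.2 (perPoly (Fin n) ℂ))))) :
    ∃ (U : Submodule ℂ (MatIdx m → ℂ)) (r δ : ℕ) (lam : Nat.Partition (m * δ)), (∀ u ∈ U, (Matrix.of fun a b : Fin m => u (toLex (a, b))).rank ≤ r) ∧ lam.parts.card ≤ m * m ∧ (let χ : Weight (MatIdx m) := (Weight.dualOfPartition (m * m) lam).toMatIdx; let T : Submodule ℂ (MvPolynomial (MatIdx m × MatIdx m) ℂ) := MvPolynomial.homogeneousSubmodule (MatIdx m × MatIdx m) ℂ (m * δ) ⊓ ((MvPolynomial.vanishingIdeal ℂ {p : MatIdx m × MatIdx m → ℂ | ∀ j :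 MatIdx m, (fun i => p (j, i)) ∈ U}) ^ (δ * (m - r))).restrictScalars ℂ ⊓ (⨅ (M : Matrix (MatIdx m) (MatIdx m) ℂ) (_ : linSubst (MatIdx m) ℂ M (detFormLex ℂ m) = detFormLex ℂ m), LinearMap.ker ((MvPolynomial.aeval (R := ℂ) fun p : MatIdx m × MatIdx m => ∑ l : MatIdx m, M l p.2 • MvPolynomial.X (p.1, l)).toLinearMap - LinearMap.id (R := ℂ) (M := MvPolynomial (MatIdx m × MatIdx m) ℂ))) ⊓ (⨅ (g : Matrix.GeneralLinearGroup (MatIdx m) ℂ) (_ : IsUpperTriangular g), LinearMap.ker ((MvPolynomial.aeval (R := ℂ) fun p : MatIdx m × MatIdx m => ∑ l : MatIdx m, ((g⁻¹ : Matrix.GeneralLinearGroup (MatIdx m) ℂ) : Matrix (MatIdx m) (MatIdx m) ℂ) p.1 l • MvPolynomial.X (l, p.2)).toLinearMap - weightChar χ g • LinearMap.id (R := ℂ) (M := MvPolynomial (MatIdx m × MatIdx m) ℂ))); Module.finrank ℂ ↥T < orbitMultiplicity ℂ (paddedPerFormLex ℂ n m) m χ) := by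
  obtain ⟨g, hg⟩ := frt_finrank_fourRowSpan_ge n m hnm hm2 M c hc
  obtain ⟨δ, lam, hcard, hlt⟩ := headCensus_at n m hnm hm2 g (hrank.trans hg)
  refine ⟨⊥, 0, δ, lam, ?_, ?_, ?_⟩
  · intro u hu
    rw [Submodule.mem_bot] at hu
    subst hu
    have h0 : (Matrix.of fun a b : Fin m => (0 : MatIdx m → ℂ) (toLex (a, b))) = 0 := by
      ext a b
      simp
    rw [h0, Matrix.rank_zero]
  · exact hcard.trans (by nlinarith)
  · intro χ T
    haveI : Module.Finite ℂ ↥(MvPolynomial.homogeneousSubmodule (MatIdx m × MatIdx m) ℂ (m * δ)) :=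
      Module.Finite.iff_fg.mpr (MvPolynomial.homogeneousSubmodule_fg (MatIdx m × MatIdx m) ℂ (m * δ))
    haveI : Module.Finite ℂ ↥(MvPolynomial.homogeneousSubmodule (MatIdx m × MatIdx m) ℂ (m * δ) ⊓
          (⨅ (P : Matrix (Fin m) (Fin m) ℂ) (Q : Matrix (Fin m) (Fin m) ℂ) (_ : P.det = 1) (_ : Q.det = 1), LinearMap.ker ((MvPolynomial.aeval fun p : MatIdx m × MatIdx m => ∑ l : MatIdx m, (P (ofLex p.2).1 (ofLex l).1 * Q (ofLex l).2 (ofLex p.2).2) • (MvPolynomial.X (p.1, l) : MvPolynomial (MatIdx m × MatIdx m) ℂ)).toLinearMap - (LinearMap.id : MvPolynomial (MatIdx m × MatIdx m) ℂ →ₗ[ℂ] MvPolynomial (MatIdx m × MatIdx m) ℂ))) ⊓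
          (⨅ (g : Matrix.GeneralLinearGroup (MatIdx m) ℂ) (_ : IsUpperTriangular g), LinearMap.ker ((MvPolynomial.aeval fun p : MatIdx m × MatIdx m => ∑ l : MatIdx m, ((g⁻¹ : Matrix.GeneralLinearGroup (MatIdx m) ℂ) : Matrix (MatIdx m) (MatIdx m) ℂ) p.1 l • (MvPolynomial.X (l, p.2) : MvPolynomial (MatIdx m × MatIdx m) ℂ)).toLinearMap - weightChar ((Weight.dualOfPartition (m * m) lam).toMatIdx : Weight (MatIdx m)) g • (LinearMap.id : MvPolynomial (MatIdx m × MatIdx m) ℂ →ₗ[ℂ] MvPolynomial (MatIdx m × MatIdx m) ℂ)))) :=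
      Submodule.finiteDimensional_of_le (inf_le_left.trans inf_le_left)
    exact lt_of_le_of_lt (Submodule.finrank_mono (inf_le_inf (le_inf (inf_le_left.trans inf_le_left)
      (inf_le_right.trans ((stub_stabInv_le_explicit m).trans inf_le_left))) le_rfl)) hlt

/-- **The head of the window from the pencil hypothesis `H`** (body form): if for all large `n`
some four-variable pencil certifies `2⌊6n/5⌋² + ⌊6n/5⌋ + 2 ≤ dim span{y_t · (∂_{ij} per_n)(M·y)}`
(the hypothesis `H` of `fourRowPencilRank_of_pencilCertificate`), then for all large `n` and every
`n ≤ m ≤ (6/5)·n` the body of `ValuativeGCT.ValuativeFlip` holds at `(n, m)`.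
[this crux, line four-row-count] -/
theorem headFlipBody_of_pencilCertificate
    (H : ∃ n₀ : ℕ, ∀ n ≥ n₀, ∃ (M : Fin n × Fin n → Fin 4 → ℂ) (c : Fin 4 → Fin n × Fin n),
      IsUnit (Matrix.of fun t t' : Fin 4 => M (c t') t) ∧
      2 * (6 * n / 5) ^ 2 + 6 * n / 5 + 2 ≤
        Module.finrank ℂ ↥(Submodule.span ℂ (Set.range fun tc : Fin 4 × (Fin n × Fin n) =>
          (X tc.1 : MvPolynomial (Fin 4) ℂ) *
            aeval (fun ij : Fin n × Fin n => ∑ t : Fin 4, M ij t • (X t : MvPolynomial (Fin 4) ℂ))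
              (pderiv tc.2 (perPoly (Fin n) ℂ))))) :
    ∃ n₀ : ℕ, ∀ n ≥ n₀, ∀ (m : ℕ) [NeZero m], n ≤ m → 5 * m ≤ 6 * n →
      ∃ (U : Submodule ℂ (MatIdx m → ℂ)) (r δ : ℕ) (lam : Nat.Partition (m * δ)), (∀ u ∈ U, (Matrix.of fun a b : Fin m => u (toLex (a, b))).rank ≤ r) ∧ lam.parts.card ≤ m * m ∧ (let χ : Weight (MatIdx m) := (Weight.dualOfPartition (m * m) lam).toMatIdx; let T : Submodule ℂ (MvPolynomial (MatIdx m × MatIdx m) ℂ) := MvPolynomial.homogeneousSubmodule (MatIdx m × MatIdx m) ℂ (m * δ) ⊓ ((MvPolynomial.vanishingIdeal ℂ {p : MatIdx m × MatIdx m → ℂ | ∀ j : MatIdx m, (fun i => p (j, i)) ∈ U}) ^ (δ * (m - r))).restrictScalars ℂ ⊓ (⨅ (M : Matrix (MatIdx m) (MatIdx m) ℂ) (_ : linSubst (MatIdx m) ℂ M (detFormLex ℂ m) = detFormLex ℂ m), LinearMap.ker ((MvPolynomial.aeval (R := ℂ) fun p : MatIdx m × MatIdx m => ∑ l : MatIdx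 m, M l p.2 • MvPolynomial.X (p.1, l)).toLinearMap - LinearMap.id (R := ℂ) (M := MvPolynomial (MatIdx m × MatIdx m) ℂ))) ⊓ (⨅ (g : Matrix.GeneralLinearGroup (MatIdx m) ℂ) (_ : IsUpperTriangular g), LinearMap.ker ((MvPolynomial.aeval (R := ℂ) fun p : MatIdx m × MatIdx m => ∑ l : MatIdx m, ((g⁻¹ : Matrix.GeneralLinearGroup (MatIdx m) ℂ) : Matrix (MatIdx m) (MatIdx m) ℂ) p.1 l • MvPolynomial.X (l, p.2)).toLinearMap - weightChar χ g • LinearMap.id (R := ℂ) (M := MvPolynomial (MatIdx m × MatIdx m) ℂ))); Module.finrank ℂ ↥T < orbitMultiplicity ℂ (paddedPerFormLex ℂ n m) m χ) := by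
  obtain ⟨n₀, hn₀⟩ := H
  refine ⟨max n₀ 2, fun n hn m _ hnm h56 => ?_⟩
  obtain ⟨M, c, hc, hrank⟩ := hn₀ n (le_of_max_le_left hn)
  have hm2 : 2 ≤ m := (le_of_max_le_right hn).trans hnm
  refine headFlipBody_of_pencilCert_at n m hnm hm2 M c hc (le_trans ?_ hrank)
  have h1 : m ≤ 6 * n / 5 := (Nat.le_div_iff_mul_le (by norm_num)).2 (by omega)
  have h2 : m ^ 2 ≤ (6 * n / 5) ^ 2 := Nat.pow_le_pow_left h1 2
  linarith

/-- **`HeadFlip` from the pencil hypothesis `H`**: the route decl `ValuativeGCT.HeadFlip`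
(sub-crux stmt-ValiantsHypothesis-15535, the linear head of the window) BY NAME, with slope
`a/b = 6/5`, from the hypothesis `H` of `fourRowPencilRank_of_pencilCertificate`.
[this crux, line four-row-count] -/
theorem headFlip_of_pencilCertificate
    (H : ∃ n₀ : ℕ, ∀ n ≥ n₀, ∃ (M : Fin n × Fin n → Fin 4 → ℂ) (c : Fin 4 → Fin n × Fin n),
      IsUnit (Matrix.of fun t t' : Fin 4 => M (c t') t) ∧
      2 * (6 * n / 5) ^ 2 + 6 * n / 5 + 2 ≤
        Module.finrank ℂ ↥(Submodule.span ℂ (Set.range fun tc : Fin 4 × (Fin n × Fin n) =>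
          (X tc.1 : MvPolynomial (Fin 4) ℂ) *
            aeval (fun ij : Fin n × Fin n => ∑ t : Fin 4, M ij t • (X t : MvPolynomial (Fin 4) ℂ))
              (pderiv tc.2 (perPoly (Fin n) ℂ))))) :
    Summit.ValiantsHypothesis.ValiantsHypothesis.Theses.ValuativeGCT.HeadFlip := by
  obtain ⟨n₀, h⟩ := headFlipBody_of_pencilCertificate H
  exact ⟨6, 5, by norm_num, n₀, fun n hn m _ hnm h56 => h n hn m hnm h56⟩

/-- **The head of the window with a general slope `a/b`** (body form): certificates of strength
`2⌊an/b⌋² + ⌊an/b⌋ + 2` at every large `n` give the body of `ValuativeGCT.ValuativeFlip` at every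
`n ≤ m`, `b·m ≤ a·n` (for `n` large).  With `a/b = 1 + ε` this is the `(2+ε')n²` form of the pencil
hypothesis used by the `HeadFlip` lead (`Cruxes/HeadFlip/Lines/four_row_count.lean`,
`fourRowPencilRank_of_pencilCertificate'`, `headFlipBody_of'`), now over landed stubs only.
[this crux, line four-row-count] -/
theorem headFlipBody_of_pencilCertificate_slope (a b : ℕ) (hb : 0 < b)
    (H : ∃ n₀ : ℕ, ∀ n ≥ n₀, ∃ (M : Fin n × Fin n → Fin 4 → ℂ) (c : Fin 4 → Fin n × Fin n),
      IsUnit (Matrix.of fun t t' : Fin 4 => M (c t') t) ∧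
      2 * (a * n / b) ^ 2 + a * n / b + 2 ≤
        Module.finrank ℂ ↥(Submodule.span ℂ (Set.range fun tc : Fin 4 × (Fin n × Fin n) =>
          (X tc.1 : MvPolynomial (Fin 4) ℂ) *
            aeval (fun ij : Fin n × Fin n => ∑ t : Fin 4, M ij t • (X t : MvPolynomial (Fin 4) ℂ))
              (pderiv tc.2 (perPoly (Fin n) ℂ))))) :
    ∃ n₀ : ℕ, ∀ n ≥ n₀, ∀ (m : ℕ) [NeZero m], n ≤ m → b * m ≤ a * n →
      ∃ (U : Submodule ℂ (MatIdx m → ℂ)) (r δ : ℕ) (lam : Nat.Partition (m * δ)), (∀ u ∈ U, (Matrix.of fun a b : Fin m => u (toLex (a, b))).rank ≤ r) ∧ lam.parts.card ≤ m * m ∧ (let χ : Weight (MatIdx m) := (Weight.dualOfPartition (m * m) lam).toMatIdx; let T : Submodule ℂ (MvPolynomial (MatIdx m × MatIdx m) ℂ) := MvPolynomial.homogeneousSubmodule (MatIdx m × MatIdx m) ℂ (m * δ) ⊓ ((MvPolynomial.vanishingIdeal ℂ {p : MatIdx m × MatIdx m → ℂ | ∀ j : MatIdx m, (fun i => p (j,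 i)) ∈ U}) ^ (δ * (m - r))).restrictScalars ℂ ⊓ (⨅ (M : Matrix (MatIdx m) (MatIdx m) ℂ) (_ : linSubst (MatIdx m) ℂ M (detFormLex ℂ m) = detFormLex ℂ m), LinearMap.ker ((MvPolynomial.aeval (R := ℂ) fun p : MatIdx m × MatIdx m => ∑ l : MatIdx m, M l p.2 • MvPolynomial.X (p.1, l)).toLinearMap - LinearMap.id (R := ℂ) (M := MvPolynomial (MatIdx m × MatIdx m) ℂ))) ⊓ (⨅ (g : Matrix.GeneralLinearGroup (MatIdx m) ℂ) (_ : IsUpperTriangular g), LinearMap.ker ((MvPolynomial.aeval (R := ℂ) fun p : MatIdx m × MatIdx m => ∑ l : MatIdx m, ((g⁻¹ : Matrix.GeneralLinearGroup (MatIdx m) ℂ) : Matrix (MatIdx m) (MatIdx m) ℂ) p.1 l • MvPolynomial.X (l, p.2)).toLinearMap - weightChar χ g • LinearMap.id (R := ℂ) (M := MvPolynomial (MatIdx m × MatIdx m) ℂ))); Module.finrank ℂ ↥T < orbitMultiplicity ℂ (paddedPerFormLex ℂ n m) m χ) := by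
  obtain ⟨n₀, hn₀⟩ := H
  refine ⟨max n₀ 2, fun n hn m _ hnm hbm => ?_⟩
  obtain ⟨M, c, hc, hrank⟩ := hn₀ n (le_of_max_le_left hn)
  have hm2 : 2 ≤ m := (le_of_max_le_right hn).trans hnm
  refine headFlipBody_of_pencilCert_at n m hnm hm2 M c hc (le_trans ?_ hrank)
  have h1 : m ≤ a * n / b := (Nat.le_div_iff_mul_le hb).2 (by simpa [Nat.mul_comm] using hbm)
  have h2 : m ^ 2 ≤ (a * n / b) ^ 2 := Nat.pow_le_pow_left h1 2
  linarith

/-- **`HeadFlip` with a general slope**: for any `b < a`, pencil certificates of strength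
`2⌊an/b⌋² + ⌊an/b⌋ + 2` at every large `n` give the route decl `ValuativeGCT.HeadFlip`
(stmt-ValiantsHypothesis-15535) BY NAME with that slope.  So ANY `(2+ε)n²` certificate closes the
sub-crux `HeadFlip` by one `exact`. [this crux, line four-row-count] -/
theorem headFlip_of_pencilCertificate_slope (a b : ℕ) (hb : 0 < b) (hba : b < a)
    (H : ∃ n₀ : ℕ, ∀ n ≥ n₀, ∃ (M : Fin n × Fin n → Fin 4 → ℂ) (c : Fin 4 → Fin n × Fin n),
      IsUnit (Matrix.of fun t t' : Fin 4 => M (c t') t) ∧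
      2 * (a * n / b) ^ 2 + a * n / b + 2 ≤
        Module.finrank ℂ ↥(Submodule.span ℂ (Set.range fun tc : Fin 4 × (Fin n × Fin n) =>
          (X tc.1 : MvPolynomial (Fin 4) ℂ) *
            aeval (fun ij : Fin n × Fin n => ∑ t : Fin 4, M ij t • (X t : MvPolynomial (Fin 4) ℂ))
              (pderiv tc.2 (perPoly (Fin n) ℂ))))) :
    Summit.ValiantsHypothesis.ValiantsHypothesis.Theses.ValuativeGCT.HeadFlip := by
  obtain ⟨n₀, h⟩ := headFlipBody_of_pencilCertificate_slope a b hb H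
  exact ⟨a, b, hba, n₀, fun n hn m _ hnm hbm => h n hn m hnm hbm⟩

end

end Summit.ValiantsHypothesis.ValiantsHypothesis.Theorems.ValuativeFlip
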